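import Summits.Ventures.HSemireg.UntwistCocycleTwistJetHigher
import HarnessLib

/-!
# Venture HSemireg — route R1.0, untwisted reading: the level-`j` Leibniz COCYCLE identity for the
# `Ωʲ`-twisted jet sequences of `E` and `E ⊗ M` (gs-g4; row `q ≥ 2` input (L2′) of
# `general-structure/LEIBNIZ-ROW2-PLAN-gs-g4.md` §5; sequel of `UntwistCocycleTwistJetHigher.lean`)

HONEST FRAMING. Module-level sheaf algebra on the tree's REAL carriers (`twistJetModule E j`, th-4's cocycle twist,
`λ_j = dualHomTwist c E Ωʲ`, `J^j_x`, `κ_x`). Nothing about any variety; no gerbe; nothing here says HC, HC_CM or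
HC_AV is proved.

For a local section `s : (E ⊗ Ωʲ)| → Pʲ(E)|` of `π_j` over `W ⊆ U_x`:
* `jetSectionUntwistHigher` — `s̃_x = t_x⁻¹ ≫ s ≫ t_x^{Pʲ(E)}`, a section of `π_j⟨c⟩ : Pʲ(E)⟨c⟩ → (E ⊗ Ωʲ)⟨c⟩`;
* `jetSectionTwistHigher` — `ŝ_x = κ_x ≫ s ≫ J^j_x`, a section of `π′_j : Pʲ(E⟨c⟩) → E⟨c⟩ ⊗ Ωʲ` (`κ_x` the local
  inverse of `λ_j`; at level `j` the right ends of the two sequences differ by `λ_j`);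
* **the cocycle identities** (for sections `s_x`, `s_y` over `W_x ⊆ U_x`, `W_y ⊆ U_y`, a local homomorphism
  `φ : E^∨| → Ωʲ|` below both, `D = (s_x φ - s_y φ).snd`):
  `s̃_x(φ ⊗ t_x) - s̃_y(φ ⊗ t_x) = ι_j⟨c⟩(D ⊗ t_x)` (`appLE_jetSectionUntwistHigher_sub`) and
  `ŝ_x(λ_j(φ ⊗ t_x)) - ŝ_y(λ_j(φ ⊗ t_x)) = ι′_j(λ_{j+1}(D ⊗ t_x) + ω_{xy} ∧ λ_j(φ ⊗ t_x))`, `ω_{xy} = -g_{xy} d g_{yx}`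
  (`appLE_jetSectionTwistHigher_sub`) — from `s_y(g φ) = g s_y(φ) + dg ∧ φ` (the twisted structure) and
  `λ_{j+1}((dg ∧ φ) ⊗ t_y) = dg ∧ λ_j(φ ⊗ t_y)`.

Which Ext groups: none (sections only); which twist: `- ⊗ M_B`, `M_B = lineBundle c`.

## References

* M. F. Atiyah, Trans. AMS 85 (1957), §4, Prop. 10, Prop. 12. [Atiyah1957]
* R.-O. Buchweitz, H. Flenner, Compositio Math. 137 (2003), §3 (`At^k`). [BuchweitzFlenner2003]
-/

noncomputable section

open CategoryTheory AlgebraicGeometry Opposite TopologicalSpace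

namespace Summit.Ventures.HSemireg

namespace CocycleTwist

open Literature.AlgebraicGeometry.Modules Literature.AlgebraicGeometry.Motives
  Literature.AlgebraicGeometry.HodgeTheory

universe u

variable {S : Type u} [CommRing S] {X : Over (Spec (CommRingCat.of S))} (c : UnitCocycle X.left)
  (E : X.left.Modules) (j : ℕ)

/-! ### Restricting `κ_x`, `κ′_x`; `ω ∧ –` calculus -/

/-- `κ′_x` restricts to `κ′_x`. [folklore] -/
theorem restrictHom_dualHomLocal (x : X.left) {W V : X.left.Opens} (hW : W ≤ c.U x) (k : V ⟶ W) :
    restrictHom k (dualHomLocal c E j x W hW) = dualHomLocal c E j x V (k.le.trans hW) := by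
  rw [dualHomLocal, dualHomLocal, restrictHom_precompOver, restrictHom_precompOver, restrictHom_toTwistOver]

/-- `κ_x` restricts to `κ_x`. [folklore] -/
theorem restrictHom_dualHomLocalInv (x : X.left) {W V : X.left.Opens} (hW : W ≤ c.U x) (k : V ⟶ W) :
    restrictHom k (dualHomLocalInv c E j x W hW) = dualHomLocalInv c E j x V (k.le.trans hW) := by
  rw [dualHomLocalInv, dualHomLocalInv, restrictHom_precompOver, restrictHom_precompOver]
  rfl

/-- `(η + η') ∧ – = η ∧ – + η' ∧ –`. [folklore] -/
theorem wedgeHomAt_add {V : X.left.Opens} (η η' : Γ(cotangentSheaf X, V)) :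
    wedgeHomAt j (η + η') = wedgeHomAt j η + wedgeHomAt j η' := by
  rw [wedgeHomAt, wedgeHomAt, wedgeHomAt, evalAt_add, Preadditive.comp_add]

/-- `(a η) ∧ – = a (η ∧ –)`. [folklore] -/
theorem wedgeHomAt_smul {V : X.left.Opens} (a : Γ(X.left, V)) (η : Γ(cotangentSheaf X, V)) :
    wedgeHomAt j (a • η) = a • wedgeHomAt j η := by
  rw [wedgeHomAt, wedgeHomAt, evalAt_smul, comp_smul_overHom]

/-- `(-η) ∧ – = -(η ∧ –)`. [folklore] -/
theorem wedgeHomAt_neg {V : X.left.Opens} (η : Γ(cotangentSheaf X, V)) : wedgeHomAt j (-η) = -wedgeHomAt j η :=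
  eq_neg_of_add_eq_zero_left (by rw [← wedgeHomAt_add, neg_add_cancel, wedgeHomAt, evalAt_zero, Limits.comp_zero])

/-- `η| ∧ –` restricts. [folklore] -/
theorem restrictHom_wedgeHomAt {V V' : X.left.Opens} (i : V' ⟶ V) (η : Γ(cotangentSheaf X, V)) :
    restrictHom i (wedgeHomAt j η) = wedgeHomAt j ((cotangentSheaf X).presheaf.map i.op η) := by
  rw [wedgeHomAt, wedgeHomAt, restrictHom_comp, restrictHom_over_map, restrictHom_evalAt]

/-! ### The transported sections -/

/-- First components of the values of a section `s` of `π_j`: `(s φ).fst = φ`. [folklore] -/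
theorem fst_appLE_sectionHigher {W : X.left.Opens} (s : (twistHodge E j).over W ⟶ (twistJetModule E j).over W)
    (hs : s ≫ (SheafOfModules.overFunctor _ W).map (twistJetπ E j) = 𝟙 _) {V : X.left.Opens} (k : V ⟶ W)
    (φ : (dual E).over V ⟶ (hodgeSheaf X j).over V) :
    TwistJetSections.fst (appLE s k (φ : Γ(twistHodge E j, V)) : TwistJetSections E j V) = φ := by
  have h := congrArg (fun ψ : (twistHodge E j).over W ⟶ (twistHodge E j).over W =>
    appLE ψ k (φ : Γ(twistHodge E j, V))) hs
  simp only [appLE_comp, appLE_over_map, appLE_id, twistJetπ_app_apply] at h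
  exact h

section Sections

variable (x : X.left) (W : X.left.Opens) (hW : W ≤ c.U x) (s : (twistHodge E j).over W ⟶ (twistJetModule E j).over W)

/-- **`s̃_x = t_x⁻¹ ≫ s ≫ t_x^{Pʲ(E)}`**: the section of `Pʲ(E)⟨c⟩ → (E ⊗ Ωʲ)⟨c⟩` over `W ⊆ U_x` transported from `s`.
[folklore] -/
def jetSectionUntwistHigher : (twist c (twistHodge E j)).over W ⟶ (twist c (twistJetModule E j)).over W :=
  ofTwistOver c (twistHodge E j) x W hW ≫ s ≫ toTwistOver c (twistJetModule E j) x W hW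

/-- **`ŝ_x = κ_x ≫ s ≫ J^j_x`**: the section of `Pʲ(E⟨c⟩) → E⟨c⟩ ⊗ Ωʲ` over `W ⊆ U_x` transported from `s`. [folklore] -/
def jetSectionTwistHigher : (twistHodge (twist c E) j).over W ⟶ (twistJetModule (twist c E) j).over W :=
  dualHomLocalInv c E j x W hW ≫ s ≫ jetTwistOverHigher c E j x W hW

variable (hs : s ≫ (SheafOfModules.overFunctor _ W).map (twistJetπ E j) = 𝟙 _)

include hs in
/-- `s̃_x` is a section of `π_j⟨c⟩`. [folklore] -/
theorem jetSectionUntwistHigher_comp_π :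
    jetSectionUntwistHigher c E j x W hW s ≫ (SheafOfModules.overFunctor _ W).map (twistMap c (twistJetπ E j)) = 𝟙 _ := by
  refine hom_ext_of_appLE fun V k e => ?_
  rw [jetSectionUntwistHigher, appLE_comp, appLE_comp, appLE_comp, appLE_over_map, appLE_toTwistOver,
    twistMap_app_trivSection, twistJetπ_app_apply, appLE_ofTwistOver]
  have h := fst_appLE_sectionHigher E j s hs k
    (((twistHodge E j).presheaf.map (homOfLE (le_inf le_rfl (k.le.trans hW) : V ≤ V ⊓ c.U x)).op
      (comp c (twistHodge E j) e x)) : (dual E).over V ⟶ (hodgeSheaf X j).over V)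
  change trivSection c (twistHodge E j) x _ (TwistJetSections.fst (appLE s k _ : TwistJetSections E j V)) = _
  rw [h, trivSection_comp_self, appLE_id]

include hs in
/-- `ŝ_x` is a section of `π′_j`. [folklore] -/
theorem jetSectionTwistHigher_comp_π :
    jetSectionTwistHigher c E j x W hW s ≫ (SheafOfModules.overFunctor _ W).map (twistJetπ (twist c E) j) = 𝟙 _ := by
  refine hom_ext_of_appLE fun V k (φ' : (dual (twist c E)).over V ⟶ (hodgeSheaf X j).over V) => ?_
  rw [jetSectionTwistHigher, appLE_comp, appLE_comp, appLE_comp, appLE_over_map, twistJetπ_app_apply,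
    appLE_jetTwistOverHigher, jetTwistFunHigher_fst]
  have h := fst_appLE_sectionHigher E j s hs k
    (appLE (dualHomLocalInv c E j x W hW) k (φ' : Γ(twistHodge (twist c E) j, V)) :
      (dual E).over V ⟶ (hodgeSheaf X j).over V)
  change (dualHomTwist c E (hodgeSheaf X j)).app V (trivSection c (twistHodge E j) x _
    (TwistJetSections.fst (appLE s k _ : TwistJetSections E j V))) = _
  rw [h, appLE_congr_hom (dualHomLocalInv c E j x W hW) k (𝟙 V ≫ k), ← appLE_restrictHom, restrictHom_dualHomLocalInv,
    ← appLE_dualHomLocal c E j x V (k.le.trans hW) (𝟙 V), ← appLE_comp, dualHomLocalInv_comp_dualHomLocal, appLE_id,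
    appLE_id]

end Sections

/-! ### The level-`j` Leibniz cocycle identity -/

section Cocycle

/-- `e ⊗ t_x` has `x`-coordinate `e`. [folklore] -/
theorem coordAt_trivSection (F : X.left.Modules) (x : X.left) {V : X.left.Opens} (hV : V ≤ c.U x) (m : Γ(F, V)) :
    coordAt c F x hV (trivSection c F x hV m) = m :=
  appLE_twistTrivOver_inv_trivSection c x V hV m

/-- `(a • p).fst = a • p.fst` on `Γ(Pʲ(F), V)` (sections spelling). [folklore] -/
theorem fst_smul_sectionsHigher {F : X.left.Modules} {V : X.left.Opens} (a : Γ(X.left, V)) (p : Γ(twistJetModule F j, V)) :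
    TwistJetSections.fst ((a • p : Γ(twistJetModule F j, V)) : TwistJetSections F j V) =
      a • TwistJetSections.fst (p : TwistJetSections F j V) := rfl

/-- `(a • p).snd = a • p.snd + da ∧ p.fst` on `Γ(Pʲ(F), V)` (sections spelling). [folklore] -/
theorem snd_smul_sectionsHigher {F : X.left.Modules} {V : X.left.Opens} (a : Γ(X.left, V)) (p : Γ(twistJetModule F j, V)) :
    TwistJetSections.snd ((a • p : Γ(twistJetModule F j, V)) : TwistJetSections F j V) =
      a • TwistJetSections.snd (p : TwistJetSections F j V) + wedgeD F j V a (TwistJetSections.fst (p : TwistJetSections F j V)) :=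
  rfl

/-- `(p - q).snd = p.snd - q.snd` on `Γ(Pʲ(F), V)` (sections spelling). [folklore] -/
theorem snd_sub_sectionsHigher {F : X.left.Modules} {V : X.left.Opens} (p q : Γ(twistJetModule F j, V)) :
    TwistJetSections.snd ((p - q : Γ(twistJetModule F j, V)) : TwistJetSections F j V) =
      TwistJetSections.snd (p : TwistJetSections F j V) - TwistJetSections.snd (q : TwistJetSections F j V) := rfl

/-- **`ψ ↦ η ∧ ψ` on `Γ(F ⊗ Ωʲ, V)`** (Γ-typed post-composition with `wedgeHomAt`). [folklore] -/
def wedgeForm (F : X.left.Modules) {V : X.left.Opens} (η : Γ(cotangentSheaf X, V)) (ψ : Γ(twistHodge F j, V)) :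
    Γ(twistHodge F (j + 1), V) :=
  ((ψ : (dual F).over V ⟶ (hodgeSheaf X j).over V) ≫ wedgeHomAt j η : (dual F).over V ⟶ (hodgeSheaf X (j + 1)).over V)

variable {x y : X.left} {Wx Wy : X.left.Opens} (hx : Wx ≤ c.U x) (hy : Wy ≤ c.U y)
  (sx : (twistHodge E j).over Wx ⟶ (twistJetModule E j).over Wx)
  (sy : (twistHodge E j).over Wy ⟶ (twistJetModule E j).over Wy)
  {V : X.left.Opens} (kx : V ⟶ Wx) (ky : V ⟶ Wy) (φ : (dual E).over V ⟶ (hodgeSheaf X j).over V)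

/-- **The `E`-side difference form at level `j`**: `D = (s_x φ - s_y φ).snd`. [folklore] -/
def diffFormHigher : (dual E).over V ⟶ (hodgeSheaf X (j + 1)).over V :=
  TwistJetSections.snd (((appLE sx kx (φ : Γ(twistHodge E j, V)) : Γ(twistJetModule E j, V)) -
    appLE sy ky (φ : Γ(twistHodge E j, V)) : Γ(twistJetModule E j, V)) : TwistJetSections E j V)

/-- `κ_x(λ_j(φ ⊗ t_x)) = φ`. [folklore] -/
theorem appLE_dualHomLocalInv_lambda :
    appLE (dualHomLocalInv c E j x Wx hx) kx
        ((dualHomTwist c E (hodgeSheaf X j)).app V (trivSection c (twistHodge E j) x (kx.le.trans hx) φ)) =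
      (φ : Γ(twistHodge E j, V)) := by
  rw [appLE_congr_hom _ kx (𝟙 V ≫ kx), ← appLE_restrictHom, restrictHom_dualHomLocalInv,
    ← appLE_dualHomLocal c E j x V (kx.le.trans hx) (𝟙 V), ← appLE_comp, dualHomLocal_comp_dualHomLocalInv, appLE_id]

/-- `ψ(r • φ) = r • ψ(φ)` for a local homomorphism `φ` (Hom-typed spelling of `appLE_smul_right`). [folklore] -/
theorem appLE_smul_right_hom {A B N : X.left.Modules} {W V : X.left.Opens} (ψ : (sheafHom A B).over W ⟶ N.over W)
    (k : V ⟶ W) (r : Γ(X.left, V)) (φ : A.over V ⟶ B.over V) :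
    appLE ψ k ((r • φ : A.over V ⟶ B.over V) : Γ(sheafHom A B, V)) = r • appLE ψ k (φ : Γ(sheafHom A B, V)) :=
  appLE_smul_right ψ k r φ

/-- `κ_y(λ_j(φ ⊗ t_x)) = g_{yx} φ`. [folklore] -/
theorem appLE_dualHomLocalInv_lambda_eq_smul :
    appLE (dualHomLocalInv c E j y Wy hy) ky
        ((dualHomTwist c E (hodgeSheaf X j)).app V (trivSection c (twistHodge E j) x (kx.le.trans hx) φ)) =
      c.g y x V (ky.le.trans hy) (kx.le.trans hx) • (φ : Γ(twistHodge E j, V)) := by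
  rw [appLE_congr_hom _ ky (𝟙 V ≫ ky), ← appLE_restrictHom, restrictHom_dualHomLocalInv,
    ← appLE_dualHomLocal c E j x V (kx.le.trans hx) (𝟙 V), ← appLE_comp,
    dualHomLocal_comp_dualHomLocalInv_eq_overScalar, appLE_overScalar, op_id, X.left.presheaf.map_id]
  rfl

variable (hsx : sx ≫ (SheafOfModules.overFunctor _ Wx).map (twistJetπ E j) = 𝟙 _)
  (hsy : sy ≫ (SheafOfModules.overFunctor _ Wy).map (twistJetπ E j) = 𝟙 _)

include hsx hsy in
/-- **Untwisted transport at level `j`: `s̃_x(φ ⊗ t_x) - s̃_y(φ ⊗ t_x) = ι_j⟨c⟩(D ⊗ t_x)`.** [cite: Atiyah1957, §4] -/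
theorem appLE_jetSectionUntwistHigher_sub :
    appLE (jetSectionUntwistHigher c E j x Wx hx sx) kx (trivSection c (twistHodge E j) x (kx.le.trans hx) φ) -
        appLE (jetSectionUntwistHigher c E j y Wy hy sy) ky (trivSection c (twistHodge E j) x (kx.le.trans hx) φ) =
      (twistMap c (twistJetι E j)).app V
        (trivSection c (twistHodge E (j + 1)) x (kx.le.trans hx) (diffFormHigher E j sx sy kx ky φ)) := by
  have hxV : V ≤ c.U x := kx.le.trans hx
  have hyV : V ≤ c.U y := ky.le.trans hy
  rw [jetSectionUntwistHigher, jetSectionUntwistHigher, appLE_comp, appLE_comp, appLE_comp, appLE_comp,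
    appLE_toTwistOver, appLE_toTwistOver, twistMap_app_trivSection, twistJetι_app_apply]
  have ex : appLE (ofTwistOver c (twistHodge E j) x Wx hx) kx (trivSection c (twistHodge E j) x hxV φ) =
      coordAt c (twistHodge E j) x hxV (trivSection c (twistHodge E j) x hxV φ) := rfl
  have ey : appLE (ofTwistOver c (twistHodge E j) y Wy hy) ky (trivSection c (twistHodge E j) x hxV φ) =
      coordAt c (twistHodge E j) y hyV (trivSection c (twistHodge E j) x hxV φ) := rfl
  rw [ex, ey, coordAt_eq_smul c (twistHodge E j) x y hxV hyV, coordAt_trivSection, appLE_smul_right,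
    ← trivSection_eq_trivSection_smul c (twistJetModule E j) x y hxV hyV, ← trivSection_sub]
  congr 1
  refine TwistJetSections.ext ?_ rfl
  change TwistJetSections.fst (appLE sx kx (φ : Γ(twistHodge E j, V)) : TwistJetSections E j V) -
      TwistJetSections.fst (appLE sy ky (φ : Γ(twistHodge E j, V)) : TwistJetSections E j V) =
    (0 : (dual E).over V ⟶ (hodgeSheaf X j).over V)
  rw [fst_appLE_sectionHigher E j sx hsx, fst_appLE_sectionHigher E j sy hsy, sub_self]

include hsx hsy in
/-- **Twisted transport at level `j` — the Leibniz cocycle identity: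
`ŝ_x(φ′) - ŝ_y(φ′) = ι′_j(λ_{j+1}(D ⊗ t_x) + ω_{xy} ∧ φ′)`**, `φ′ = λ_j(φ ⊗ t_x)`, `ω_{xy} = -g_{xy} d g_{yx}`.
[cite: Atiyah1957, §4 and Prop. 12] -/
theorem appLE_jetSectionTwistHigher_sub :
    appLE (jetSectionTwistHigher c E j x Wx hx sx) kx
          ((dualHomTwist c E (hodgeSheaf X j)).app V (trivSection c (twistHodge E j) x (kx.le.trans hx) φ)) -
        appLE (jetSectionTwistHigher c E j y Wy hy sy) ky
          ((dualHomTwist c E (hodgeSheaf X j)).app V (trivSection c (twistHodge E j) x (kx.le.trans hx) φ)) =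
      (twistJetι (twist c E) j).app V
        ((dualHomTwist c E (hodgeSheaf X (j + 1))).app V
            (trivSection c (twistHodge E (j + 1)) x (kx.le.trans hx) (diffFormHigher E j sx sy kx ky φ)) +
          wedgeForm j (twist c E) (dlogForm c x y V (kx.le.trans hx) (ky.le.trans hy))
            ((dualHomTwist c E (hodgeSheaf X j)).app V (trivSection c (twistHodge E j) x (kx.le.trans hx) φ))) := by
  have hxV : V ≤ c.U x := kx.le.trans hx
  have hyV : V ≤ c.U y := ky.le.trans hy
  rw [jetSectionTwistHigher, jetSectionTwistHigher, appLE_comp, appLE_comp, appLE_comp, appLE_comp,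
    appLE_jetTwistOverHigher, appLE_jetTwistOverHigher, twistJetι_app_apply, appLE_dualHomLocalInv_lambda c E j hx kx φ,
    appLE_dualHomLocalInv_lambda_eq_smul c E j hx hy kx ky φ, appLE_smul_right_hom]
  refine TwistJetSections.ext ?_ ?_
  · change (jetTwistFunHigher c E j x hxV (appLE sx kx (φ : Γ(twistHodge E j, V)))).fst -
        (jetTwistFunHigher c E j y hyV (c.g y x V hyV hxV • appLE sy ky (φ : Γ(twistHodge E j, V)))).fst =
      (0 : (dual (twist c E)).over V ⟶ (hodgeSheaf X j).over V)
    rw [jetTwistFunHigher_fst, jetTwistFunHigher_fst, fst_smul_sectionsHigher, fst_appLE_sectionHigher E j sx hsx,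
      fst_appLE_sectionHigher E j sy hsy, ← trivSection_eq_trivSection_smul_hom c x y hxV hyV, sub_self]
  · change (jetTwistFunHigher c E j x hxV (appLE sx kx (φ : Γ(twistHodge E j, V)))).snd -
        (jetTwistFunHigher c E j y hyV (c.g y x V hyV hxV • appLE sy ky (φ : Γ(twistHodge E j, V)))).snd = _
    rw [jetTwistFunHigher_snd, jetTwistFunHigher_snd, snd_smul_sectionsHigher, fst_appLE_sectionHigher E j sy hsy,
      trivSection_add_hom, map_add, ← trivSection_eq_trivSection_smul_hom c x y hxV hyV, wedgeD_eq_comp_wedgeHomAt,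
      dualHomTwist_app_trivSection_comp_id, trivSection_eq_trivSection_smul_hom c y x hyV hxV, trivSection_smul_hom,
      Scheme.Modules.Hom.app_smul, TwistJetSections.snd_mk, diffFormHigher, dlogForm, wedgeForm, wedgeHomAt_neg,
      wedgeHomAt_smul, Preadditive.comp_neg, comp_smul_overHom, snd_sub_sectionsHigher, trivSection_sub_hom, map_sub]
    change _ = _ + -(c.g x y V hxV hyV • ((((dualHomTwist c E (hodgeSheaf X j)).app V
      (trivSection c (twistHodge E j) x hxV φ)) : (dual (twist c E)).over V ⟶ (hodgeSheaf X j).over V) ≫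
        wedgeHomAt j (dSection X V (c.g y x V hyV hxV))))
    rw [← smul_comp_overHom]
    abel

end Cocycle

end CocycleTwist

end Summit.Ventures.HSemireg

end
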